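import Mathlib.LinearAlgebra.RootSystem.Base
import Mathlib.LinearAlgebra.RootSystem.CartanMatrix
import Mathlib.LinearAlgebra.RootSystem.BaseChange
import Mathlib.LinearAlgebra.RootSystem.Finite.Nondegenerate
import Mathlib.LinearAlgebra.LinearIndependent.BaseChange
import Mathlib.LinearAlgebra.FreeModule.PID
import Mathlib.LinearAlgebra.Dual.Lemmas
import HarnessLib

/-!
# Base change of a root datum from `ℤ` to a field of characteristic zero

Trunk T-AUTOMORPHIC (G25 AutomorphicL); auxiliary to Chevalley's existence theorem
(`Literature.NumberTheory.Automorphic.chevalley_existence`, Springer, *Linear Algebraic Groups*,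
2nd ed., 7.4, 10.1.1). A root datum `P : RootPairing ι ℤ X Y` (perfect pairing of finitely
generated abelian groups) has free `X`, `Y` (`free_of_rootPairing`); choosing a `ℤ`-basis of `X`
we realise `K ⊗ P` on coordinates: `baseChange P K : RootPairing ι K (Fin r → K) (Dual K (Fin r → K))`
(roots: coordinate vectors of the roots; coroots: the functionals `v ↦ ∑ ⟨x_s, α^∨⟩ v_s`), which
is crystallographic and reduced when `P` is. Restricting to the spans of roots and coroots
(Mathlib `RootPairing.restrictScalars'`) gives the **root system `rootSystemOf P K` of the root
datum** over `K`, and a base `b` of `P` gives a base `baseOf b K` of it with the **same Cartan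
matrix** (`cartanMatrix_baseOf`). As a consequence the **Cartan matrix of a base of a root datum
is non-degenerate** (`cartanMatrix_nondegenerate_int`, from Mathlib's theorem for root systems,
applied over `ℚ`). Everything is proved; the statements are [folklore] (Springer 7.4, SGA 3 XXI 1.1).

## Mathlib

`RootPairing.restrictScalars'`, `RootPairing.Base`, `RootPairing.Base.cartanMatrix_nondegenerate`,
`linearIndependent_algebraMap_comp_iff`, `Module.free_of_finite_type_torsion_free'`,
`LinearMap.IsPerfPair`, `Module.Dual.eval`. Mathlib has restriction but no extension of scalars
for root pairings (`Mathlib/LinearAlgebra/RootSystem/BaseChange.lean`, TODO); this file supplies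
the case `ℤ → K` needed here, on coordinates.
-/

noncomputable section

open Module Set Function

namespace Literature.NumberTheory.Automorphic

namespace RootDatumBaseChange

variable {ι X Y : Type*} [AddCommGroup X] [AddCommGroup Y] (P : RootPairing ι ℤ X Y)

/-! ### Root data have free lattices -/

/-- The weight lattice of a root datum is torsion-free (it embeds in `Hom(Y, ℤ)`). [folklore] -/
theorem noZeroSMulDivisors_of_rootPairing (P : RootPairing ι ℤ X Y) : NoZeroSMulDivisors ℤ X := by
  refine ⟨fun {c x} h => or_iff_not_imp_left.2 fun hc => ?_⟩
  apply P.toLinearMap.toPerfPair.injective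
  rw [map_zero]
  ext y
  have h1 : c * P.toLinearMap x y = 0 := by
    have := congrArg (fun z => P.toLinearMap z y) h
    simpa using this
  rw [LinearMap.toPerfPair_apply, LinearMap.zero_apply]
  exact (mul_eq_zero.1 h1).resolve_left hc

/-- **The weight lattice of a root datum is free** (finitely generated and torsion-free).
[folklore] -/
theorem free_of_rootPairing (P : RootPairing ι ℤ X Y) [Module.Finite ℤ X] : Module.Free ℤ X := by
  have := noZeroSMulDivisors_of_rootPairing P
  exact Module.free_of_finite_type_torsion_free'

/-- The coweight lattice of a root datum is free. [folklore] -/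
theorem free_of_rootPairing_right (P : RootPairing ι ℤ X Y) [Module.Finite ℤ Y] : Module.Free ℤ Y :=
  free_of_rootPairing P.flip

/-! ### Coordinates -/

section Coord

variable [Module.Finite ℤ X] (K : Type*) [Field K] [CharZero K]

/-- The rank `r` of the weight lattice. [folklore] -/
def rk (P : RootPairing ι ℤ X Y) : ℕ := by
  have := free_of_rootPairing P
  exact Module.finrank ℤ X

/-- A `ℤ`-basis of the weight lattice. [folklore] -/
def basisX (P : RootPairing ι ℤ X Y) : Module.Basis (Fin (rk P)) ℤ X := by
  have := free_of_rootPairing P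
  exact Module.finBasis ℤ X

/-- The integer coordinates of a weight. [folklore] -/
def coordZ : X →ₗ[ℤ] (Fin (rk P) → ℤ) :=
  (Finsupp.linearEquivFunOnFinite ℤ ℤ (Fin (rk P))).toLinearMap ∘ₗ (basisX P).repr.toLinearMap

/-- `coordZ` is injective. [folklore] -/
lemma coordZ_injective : Function.Injective (coordZ P) :=
  (Finsupp.linearEquivFunOnFinite ℤ ℤ (Fin (rk P))).injective.comp (basisX P).repr.injective

/-- `coordZ x s` is the `s`-th coordinate. [folklore] -/
lemma coordZ_apply (x : X) (s : Fin (rk P)) : coordZ P x s = (basisX P).repr x s := rfl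

/-- The `K`-valued coordinates of a weight (`x ↦ (x_s)` with `x = ∑ x_s e_s`). [folklore] -/
def coordK : X →+ (Fin (rk P) → K) where
  toFun x := algebraMap ℤ K ∘ coordZ P x
  map_zero' := by ext s; simp
  map_add' x x' := by ext s; simp

omit [CharZero K] in
/-- `coordK x = algebraMap ℤ K ∘ coordZ x`. [folklore] -/
lemma coordK_eq (x : X) : coordK P K x = algebraMap ℤ K ∘ coordZ P x := rfl

omit [CharZero K] in
/-- `coordK x s = (coordZ x s : K)`. [folklore] -/
lemma coordK_apply (x : X) (s : Fin (rk P)) : coordK P K x s = (coordZ P x s : K) := rfl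

/-- `coordK` is injective (characteristic `0`). [folklore] -/
lemma coordK_injective : Function.Injective (coordK P K) := by
  intro x x' h
  apply coordZ_injective P
  funext s
  have := congrFun h s
  rw [coordK_apply, coordK_apply] at this
  exact_mod_cast this

omit [CharZero K] in
/-- `coordK (n • x) = n • coordK x`. [folklore] -/
lemma coordK_zsmul (n : ℤ) (x : X) : coordK P K (n • x) = (n : K) • coordK P K x := by
  rw [map_zsmul]
  exact (Int.cast_smul_eq_zsmul K n _).symm

/-- The integer coordinates of a coweight, through the pairing: `y ↦ (⟨e_s, y⟩)_s`. [folklore] -/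
def cocoordZ : Y →ₗ[ℤ] (Fin (rk P) → ℤ) :=
  LinearMap.pi fun s => P.toLinearMap (basisX P s)

/-- `cocoordZ y s = ⟨e_s, y⟩`. [folklore] -/
lemma cocoordZ_apply (y : Y) (s : Fin (rk P)) : cocoordZ P y s = P.toLinearMap (basisX P s) y := rfl

/-- `cocoordZ` is injective (the pairing is perfect). [folklore] -/
lemma cocoordZ_injective : Function.Injective (cocoordZ P) := by
  rw [← LinearMap.ker_eq_bot, Submodule.eq_bot_iff]
  intro y hy
  rw [LinearMap.mem_ker] at hy
  apply P.toLinearMap.flip.toPerfPair.injective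
  rw [map_zero]
  ext x
  rw [LinearMap.toPerfPair_apply, LinearMap.flip_apply, LinearMap.zero_apply,
    ← (basisX P).sum_repr x, map_sum, LinearMap.sum_apply]
  refine Finset.sum_eq_zero fun s _ => ?_
  rw [map_zsmul, LinearMap.smul_apply, ← cocoordZ_apply, hy, Pi.zero_apply, smul_zero]

/-- The coroot functional on coordinate space: `v ↦ ∑_s ⟨e_s, y⟩ v_s`. [folklore] -/
def cocoordK : Y →+ Module.Dual K (Fin (rk P) → K) where
  toFun y := ∑ s, (P.toLinearMap (basisX P s) y : K) • LinearMap.proj s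
  map_zero' := by simp
  map_add' y y' := by
    rw [← Finset.sum_add_distrib]
    refine Finset.sum_congr rfl fun s _ => ?_
    rw [map_add, Int.cast_add, add_smul]

omit [CharZero K] in
/-- `cocoordK y v = ∑_s ⟨e_s, y⟩ v_s`. [folklore] -/
lemma cocoordK_apply (y : Y) (v : Fin (rk P) → K) :
    cocoordK P K y v = ∑ s, (P.toLinearMap (basisX P s) y : K) * v s := by
  simp [cocoordK]

omit [CharZero K] in
/-- **The coordinate pairing is the pairing of the root datum**: `cocoordK y (coordK x) = ⟨x, y⟩`.
[folklore] -/
theorem cocoordK_coordK (x : X) (y : Y) :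
    cocoordK P K y (coordK P K x) = (P.toLinearMap x y : K) := by
  rw [cocoordK_apply]
  conv_rhs => rw [← (basisX P).sum_repr x, map_sum, LinearMap.sum_apply]
  push_cast
  refine Finset.sum_congr rfl fun s _ => ?_
  rw [coordK_apply, coordZ_apply, map_zsmul, LinearMap.smul_apply, smul_eq_mul, Int.cast_mul, mul_comm]

/-- `cocoordK` is injective. [folklore] -/
lemma cocoordK_injective : Function.Injective (cocoordK P K) := by
  intro y y' h
  apply cocoordZ_injective P
  funext s
  have h1 := congrArg (fun f : Module.Dual K (Fin (rk P) → K) => f (Pi.single s 1)) h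
  simp only [cocoordK_apply, Pi.single_apply, mul_ite, mul_one, mul_zero, Finset.sum_ite_eq',
    Finset.mem_univ, if_true] at h1
  rw [cocoordZ_apply, cocoordZ_apply]
  exact_mod_cast h1

omit [CharZero K] in
/-- `cocoordK (n • y) = n • cocoordK y`. [folklore] -/
lemma cocoordK_zsmul (n : ℤ) (y : Y) : cocoordK P K (n • y) = (n : K) • cocoordK P K y := by
  rw [map_zsmul]
  exact (Int.cast_smul_eq_zsmul K n _).symm

end Coord

/-! ### The base change on coordinates -/

section BaseChange

variable [Module.Finite ℤ X] (K : Type*) [Field K] [CharZero K]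

/-- **The base change `K ⊗ P` of a root datum, on coordinates**: module `K^r`, dual module its
dual, roots the coordinate vectors of the roots, coroots the functionals of the coroots.
[folklore] -/
def baseChange : RootPairing ι K (Fin (rk P) → K) (Module.Dual K (Fin (rk P) → K)) where
  toLinearMap := Module.Dual.eval K (Fin (rk P) → K)
  root := ⟨fun i => coordK P K (P.root i), (coordK_injective P K).comp P.root.injective⟩
  coroot := ⟨fun i => cocoordK P K (P.coroot i), (cocoordK_injective P K).comp P.coroot.injective⟩
  root_coroot_two i := by
    change cocoordK P K (P.coroot i) (coordK P K (P.root i)) = 2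
    rw [cocoordK_coordK, P.root_coroot_two, Int.cast_two]
  reflectionPerm := P.reflectionPerm
  reflectionPerm_root i j := by
    change coordK P K (P.root j) - cocoordK P K (P.coroot i) (coordK P K (P.root j)) •
      coordK P K (P.root i) = coordK P K (P.root (P.reflectionPerm i j))
    rw [cocoordK_coordK, ← P.reflectionPerm_root, map_sub, coordK_zsmul]
  reflectionPerm_coroot i j := by
    change cocoordK P K (P.coroot j) - cocoordK P K (P.coroot j) (coordK P K (P.root i)) •
      cocoordK P K (P.coroot i) = cocoordK P K (P.coroot (P.reflectionPerm i j))
    rw [cocoordK_coordK, ← P.reflectionPerm_coroot, map_sub, cocoordK_zsmul]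

/-- The roots of the base change. [folklore] -/
@[simp] lemma baseChange_root (i : ι) : (baseChange P K).root i = coordK P K (P.root i) := rfl

/-- The coroots of the base change. [folklore] -/
@[simp] lemma baseChange_coroot (i : ι) : (baseChange P K).coroot i = cocoordK P K (P.coroot i) := rfl

/-- The reflection permutations of the base change are those of `P`. [folklore] -/
@[simp] lemma baseChange_reflectionPerm : (baseChange P K).reflectionPerm = P.reflectionPerm := rfl

/-- The pairing of the base change. [folklore] -/
lemma baseChange_toLinearMap_apply (v : Fin (rk P) → K) (f : Module.Dual K (Fin (rk P) → K)) :
    (baseChange P K).toLinearMap v f = f v := rfl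

/-- **The root–coroot pairings of the base change are those of `P`.** [folklore] -/
@[simp] lemma baseChange_pairing (i j : ι) : (baseChange P K).pairing i j = (P.pairing i j : K) := by
  rw [RootPairing.pairing, baseChange_toLinearMap_apply, baseChange_root, baseChange_coroot,
    cocoordK_coordK]
  rfl

/-- The base change is crystallographic. [folklore] -/
instance instIsCrystallographic : (baseChange P K).IsCrystallographic where
  exists_value i j := ⟨P.pairing i j, by rw [baseChange_pairing]; rfl⟩

/-- Linear (in)dependence of families of roots is unchanged by the base change. [folklore] -/
theorem linearIndependent_baseChange_root_iff {κ : Type*} (f : κ → ι) :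
    LinearIndependent K (fun c => (baseChange P K).root (f c)) ↔
      LinearIndependent ℤ (fun c => P.root (f c)) := by
  have h1 : (fun c => (baseChange P K).root (f c)) =
      fun c => algebraMap ℤ K ∘ (coordZ P (P.root (f c))) := rfl
  rw [h1, linearIndependent_algebraMap_comp_iff]
  exact (LinearMap.linearIndependent_iff_of_injOn (coordZ P) (coordZ_injective P).injOn)

/-- The base change of a reduced root datum is reduced. [folklore] -/
instance instIsReduced [P.IsReduced] : (baseChange P K).IsReduced where
  eq_or_eq_neg i j h := by
    have e1 : (fun c => (baseChange P K).root (![i, j] c)) =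
        ![(baseChange P K).root i, (baseChange P K).root j] := by
      funext c; fin_cases c <;> rfl
    have e2 : (fun c => P.root (![i, j] c)) = ![P.root i, P.root j] := by
      funext c; fin_cases c <;> rfl
    have h' : ¬ LinearIndependent ℤ ![P.root i, P.root j] := by
      rw [← e2, ← linearIndependent_baseChange_root_iff P K, e1]; exact h
    rcases RootPairing.IsReduced.eq_or_eq_neg i j h' with h3 | h3
    · left; rw [baseChange_root, baseChange_root, h3]
    · right; rw [baseChange_root, baseChange_root, h3, map_neg]

end BaseChange

/-! ### Coordinates of coroots and linear independence -/

section CorootCoord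

variable [Module.Finite ℤ X] (K : Type*) [Field K] [CharZero K]

/-- Evaluation of functionals at the standard basis vectors. [folklore] -/
def evalVec : Module.Dual K (Fin (rk P) → K) →ₗ[K] (Fin (rk P) → K) :=
  LinearMap.pi fun s => LinearMap.applyₗ (Pi.single s 1)

omit [CharZero K] in
/-- `evalVec` is injective (a functional is determined by its values on the basis). [folklore] -/
lemma evalVec_injective : Function.Injective (evalVec P K) := by
  intro f g h
  refine (Pi.basisFun K (Fin (rk P))).ext fun s => ?_
  have := congrFun h s
  simpa [evalVec] using this

omit [CharZero K] in
/-- `evalVec (cocoordK y) = (⟨e_s, y⟩)_s`. [folklore] -/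
lemma evalVec_cocoordK (y : Y) : evalVec P K (cocoordK P K y) = algebraMap ℤ K ∘ cocoordZ P y := by
  funext s
  simp [evalVec, cocoordK_apply, Pi.single_apply, cocoordZ_apply]

/-- Linear (in)dependence of families of coroots is unchanged by the base change. [folklore] -/
theorem linearIndependent_baseChange_coroot_iff {κ : Type*} (f : κ → ι) :
    LinearIndependent K (fun c => (baseChange P K).coroot (f c)) ↔
      LinearIndependent ℤ (fun c => P.coroot (f c)) := by
  rw [← LinearMap.linearIndependent_iff_of_injOn (evalVec P K) (evalVec_injective P K).injOn]
  have h1 : (evalVec P K) ∘ (fun c => (baseChange P K).coroot (f c)) =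
      fun c => algebraMap ℤ K ∘ (cocoordZ P (P.coroot (f c))) := by
    funext c
    exact evalVec_cocoordK P K _
  rw [h1, linearIndependent_algebraMap_comp_iff]
  exact LinearMap.linearIndependent_iff_of_injOn (cocoordZ P) (cocoordZ_injective P).injOn

end CorootCoord

/-! ### The root system over `K` and its base -/

section RootSystem

variable [Module.Finite ℤ X] [Fintype ι] (K : Type*) [Field K] [CharZero K]

/-- **The root system of the root datum over `K`**: the base change restricted to the spans of
the roots and of the coroots (Mathlib `RootPairing.restrictScalars'`); it is a finite reduced
crystallographic root system. [folklore] -/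
abbrev rootSystemOf : RootPairing ι K (Submodule.span K (range (baseChange P K).root))
    (Submodule.span K (range (baseChange P K).coroot)) :=
  (baseChange P K).restrictScalars K

/-- The pairings of the root system over `K` are those of `P`. [folklore] -/
@[simp] lemma rootSystemOf_pairing (i j : ι) : (rootSystemOf P K).pairing i j = (P.pairing i j : K) := by
  have h := RootPairing.restrictScalars_pairing (baseChange P K) K i j
  rw [Algebra.algebraMap_self, RingHom.id_apply] at h
  rw [rootSystemOf, RootPairing.restrictScalars, h, baseChange_pairing]

/-- The root system over `K` is crystallographic, with the integer pairings of `P`. [folklore] -/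
instance instIsCrystallographicRootSystemOf : (rootSystemOf P K).IsCrystallographic where
  exists_value i j := ⟨P.pairing i j, by rw [rootSystemOf_pairing]; rfl⟩

/-- `pairingIn ℤ` of the root system over `K` is the pairing of `P`. [folklore] -/
lemma rootSystemOf_pairingIn (i j : ι) : (rootSystemOf P K).pairingIn ℤ i j = P.pairing i j := by
  have h := (rootSystemOf P K).algebraMap_pairingIn ℤ i j
  rw [rootSystemOf_pairing, eq_intCast] at h
  exact_mod_cast h

/-- The root system over `K` of a reduced root datum is reduced. [folklore] -/
instance instIsReducedRootSystemOf [P.IsReduced] : (rootSystemOf P K).IsReduced where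
  eq_or_eq_neg i j h := by
    have h' : ¬ LinearIndependent K ![(baseChange P K).root i, (baseChange P K).root j] := by
      intro h2
      apply h
      have e : (Submodule.span K (range (baseChange P K).root)).subtype ∘
          ![(rootSystemOf P K).root i, (rootSystemOf P K).root j] =
          ![(baseChange P K).root i, (baseChange P K).root j] := by
        funext c; fin_cases c <;> rfl
      rw [← e] at h2
      exact h2.of_comp
    rcases RootPairing.IsReduced.eq_or_eq_neg i j h' with h3 | h3
    · left; exact Subtype.ext h3
    · right; exact Subtype.ext h3

variable {P K}

/-- Transfer of `ℕ`-closure membership from `P` to the root system over `K` (roots).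
[folklore] -/
lemma exists_mem_closure_root (S : Set ι) {x : X}
    (hx : x ∈ AddSubmonoid.closure (P.root '' S)) :
    ∃ m : Submodule.span K (range (baseChange P K).root),
      m ∈ AddSubmonoid.closure ((rootSystemOf P K).root '' S) ∧ (m : Fin (rk P) → K) = coordK P K x := by
  induction hx using AddSubmonoid.closure_induction with
  | mem x hx =>
    obtain ⟨j, hj, rfl⟩ := hx
    exact ⟨(rootSystemOf P K).root j, AddSubmonoid.subset_closure ⟨j, hj, rfl⟩, rfl⟩
  | zero => exact ⟨0, AddSubmonoid.zero_mem _, by simp⟩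
  | add x y _ _ hx hy =>
    obtain ⟨m, hm, hmx⟩ := hx
    obtain ⟨m', hm', hmy⟩ := hy
    exact ⟨m + m', AddSubmonoid.add_mem _ hm hm', by simp [hmx, hmy]⟩

/-- Transfer of `ℕ`-closure membership from `P` to the root system over `K` (coroots).
[folklore] -/
lemma exists_mem_closure_coroot (S : Set ι) {y : Y}
    (hy : y ∈ AddSubmonoid.closure (P.coroot '' S)) :
    ∃ m : Submodule.span K (range (baseChange P K).coroot),
      m ∈ AddSubmonoid.closure ((rootSystemOf P K).coroot '' S) ∧
        (m : Module.Dual K (Fin (rk P) → K)) = cocoordK P K y := by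
  induction hy using AddSubmonoid.closure_induction with
  | mem y hy =>
    obtain ⟨j, hj, rfl⟩ := hy
    exact ⟨(rootSystemOf P K).coroot j, AddSubmonoid.subset_closure ⟨j, hj, rfl⟩, rfl⟩
  | zero => exact ⟨0, AddSubmonoid.zero_mem _, by simp⟩
  | add y y' _ _ hy hy' =>
    obtain ⟨m, hm, hmy⟩ := hy
    obtain ⟨m', hm', hmy'⟩ := hy'
    exact ⟨m + m', AddSubmonoid.add_mem _ hm hm', by simp [hmy, hmy']⟩

variable (P K)

/-- **A base of the root datum gives a base of its root system over `K`**, with the same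
support. [folklore] -/
def baseOf (b : P.Base) : (rootSystemOf P K).Base where
  support := b.support
  linearIndepOn_root := by
    have h := (linearIndependent_baseChange_root_iff P K (fun x : b.support => (x : ι))).2
      b.linearIndepOn_root
    exact h.of_comp (Submodule.span K (range (baseChange P K).root)).subtype
  linearIndepOn_coroot := by
    have h := (linearIndependent_baseChange_coroot_iff P K (fun x : b.support => (x : ι))).2
      b.linearIndepOn_coroot
    exact h.of_comp (Submodule.span K (range (baseChange P K).coroot)).subtype
  root_mem_or_neg_mem i := by
    rcases b.root_mem_or_neg_mem i with h | h
    · obtain ⟨m, hm, hmx⟩ := exists_mem_closure_root (K := K) _ h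
      left
      convert hm
      exact Subtype.ext hmx.symm
    · obtain ⟨m, hm, hmx⟩ := exists_mem_closure_root (K := K) _ h
      right
      convert hm
      refine Subtype.ext ?_
      rw [map_neg] at hmx
      change -coordK P K (P.root i) = (m : Fin (rk P) → K)
      exact hmx.symm
  coroot_mem_or_neg_mem i := by
    rcases b.coroot_mem_or_neg_mem i with h | h
    · obtain ⟨m, hm, hmy⟩ := exists_mem_closure_coroot (K := K) _ h
      left
      convert hm
      exact Subtype.ext hmy.symm
    · obtain ⟨m, hm, hmy⟩ := exists_mem_closure_coroot (K := K) _ h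
      right
      convert hm
      refine Subtype.ext ?_
      rw [map_neg] at hmy
      change -cocoordK P K (P.coroot i) = (m : Module.Dual K (Fin (rk P) → K))
      exact hmy.symm

/-- The support of `baseOf b` is that of `b`. [folklore] -/
@[simp] lemma baseOf_support (b : P.Base) : (baseOf P K b).support = b.support := rfl

/-- **The Cartan matrix is unchanged by the base change.** [folklore] -/
theorem cartanMatrix_baseOf (b : P.Base) : (baseOf P K b).cartanMatrix = b.cartanMatrix := by
  ext i j
  change (rootSystemOf P K).pairingIn ℤ i j = P.pairingIn ℤ i j
  rw [rootSystemOf_pairingIn]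
  exact (P.algebraMap_pairingIn ℤ i j).symm.trans (by simp)

end RootSystem

/-- **The Cartan matrix of a base of a (finite, reduced or not) root datum over `ℤ` is
non-degenerate** (Mathlib's `RootPairing.Base.cartanMatrix_nondegenerate` for the root system
of the datum over `ℚ`). [folklore] -/
theorem cartanMatrix_nondegenerate_int [Finite ι] [Module.Finite ℤ X] (b : P.Base) :
    b.cartanMatrix.Nondegenerate := by
  have := Fintype.ofFinite ι
  rw [← cartanMatrix_baseOf P ℚ b]
  exact (baseOf P ℚ b).cartanMatrix_nondegenerate

end RootDatumBaseChange

end Literature.NumberTheory.Automorphic
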